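import Literature.NumberTheory.Rogawski1990.CartanRealisation
import Literature.NumberTheory.Rogawski1990.CartanAlgebra
import HarnessLib

/-!
# The `(2,1)` block frame of a unitary element with an irreducible quadratic block (Cartan subgroup of TYPE (2)): the Gram matrix and the
# adjoint `⋆` in the frame, and the `⋆`-algebra `E_v[A]` of the quadratic block (Rogawski 1990, §3.5 Prop. 3.5.2 (a) p. 29, §3.6 p. 31)

Topic `NumberTheory/Rogawski1990`; namespace `Literature.NumberTheory.Rogawski1990`.  THEOREMS ONLY (no definition, no named fact, no instance, no
notation, no `sorry`).  Cell `pub/hodgecm-mathlib`, programme P3a, road «D-N7-inert» (the inert unit fundamental lemma [Rogawski1990, Prop. 4.9.1 (b)]),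
brick (L4a) «local class set», TYPE (2) — the FRAME half (any field `K` with an involution `σ`), companion of ★ `LocalStableClassesNonsplit` §1 (B-p04:
the EIGENFRAME of type (1)).  HC_CM is proved only modulo the printed citations until rung 0 closes; this file is unconditional matrix algebra.

THE PRINT.  [Rogawski1990, §3.6 p. 31]: «Type (2): `T_K × E¹`, where `K` is a quadratic extension of `F` distinct from `E`» (`L′ = KE`, `α′` the
automorphism of the second kind fixing `K`); [§3.5 Prop. 3.5.2 (a)]: `H¹(F,T) ≅ L∕N_{L′∕L}(L′^*)`.  MODEL: `γ ∈ U(H)(K)` (`H ∈ GL_n(K)` `σ`-hermitian) with a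
BLOCK FRAME `γ P = P · [A 0; 0 u]` (`e : m ⊕ Fin 1 ≃ n`, `A ∈ M_m(K)` WITHOUT eigenvalues in `K`, `u ∈ K`): then
* §1 (block calculus) products, adjoint-transposes, determinants and inverses of `reindex e e (fromBlocks Y 0 0 !![t])`;
* §2 the Gram matrix `H_P = ᵗ(σP) H P` is BLOCK-DIAGONAL `[G₁ 0; 0 g₃]` (`twistGram_blockFrame_eq`: the `u`-line is `H`-orthogonal to the `A`-block because
  `ᵗ(σA)` and `A` have no eigenvalue — the analogue of ★ `twistGram_eigenframe_eq_diagonal`), with `ᵗ(σA) G₁ A = G₁`, `σ(u) u = 1`, `G₁` hermitian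
  invertible, `g₃ = σ g₃ ≠ 0`; the adjoint in the frame `(P S P⁻¹)⋆ = P (S⋆_{H_P}) P⁻¹` (`hermStar_frame`) hence
  `(P [Y 0; 0 t] P⁻¹)⋆ = P [Y⋆_{G₁} 0; 0 σt] P⁻¹` (`hermStar_blockFrame`); the transported Gram matrix of a stable conjugator `H_{gP} = H_P · (P⁻¹ x P)`
  (`twistGram_mul_frame_eq`, `x = H⁻¹ H_g ∈ Z(γ)`);
* §3 (`m = Fin 2`) the commutant of `A` is `K[A] = {α + βA}` (`exists_eq_smul_add_smul_of_commute_fin_two`), a commutative algebra in which every non-zero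
  element is invertible (`det (α + βA) ≠ 0`), stable under `⋆_{G₁}` with `A⋆ = A⁻¹`; it contains a NON-SCALAR `⋆`-FIXED element `κ` with `κ² = k₀ · 1`,
  `σ k₀ = k₀` (`exists_hermStar_eq_sq_eq_smul_one`: `ξ = A + A⁻¹` or `η = δ(A − A⁻¹)`, complete the square) — so that `K[A]^{⋆} = F ⊕ F κ ≅ F(√k₀)` is
  Rogawski's quadratic field `K = (L′)^{α′}` of type (2) — and in the coordinates `Y = α + βκ`: `Y⋆ = σα + σβ κ`, `det Y = α² − k₀ β²`.
The COUNT at a non-split place (two classes, `κ_H`) is the sequel `LocalStableClassesNonsplitTypeTwoCount` (over ★ `HilbertSymbolRegularQuadraticExtension`).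

## References
* [Rogawski1990] J. D. Rogawski, *Automorphic Representations of Unitary Groups in Three Variables*, Ann. of Math. Stud. 123 (1990), §3.1 p. 19, §3.5
  Prop. 3.5.2 p. 29, §3.6 p. 31.
* [Kottwitz1986] R. E. Kottwitz, *Stable trace formula: elliptic singular terms*, Math. Ann. 275 (1986), §7.
-/

set_option autoImplicit false

noncomputable section

open Matrix
open scoped MatrixGroups

namespace Literature.NumberTheory.Rogawski1990

open Literature.AlgebraicGeometry.ShimuraVarieties (unitaryGroup mem_unitaryGroup_iff)

/-! ## §1 Block calculus for `[Y 0; 0 t]` in a frame `e : m ⊕ Fin 1 ≃ n` -/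

section Block

variable {K : Type*} [Field K] (σ : K →+* K) {m n : Type*} (e : m ⊕ Fin 1 ≃ n)

/-- `[Y 0; 0 t] · [Y′ 0; 0 t′] = [YY′ 0; 0 tt′]`. [cite: HornJohnson2013, §0.9.2 (block diagonal matrices and direct sums)] -/
theorem blockFrame_mul [Fintype m] [Fintype n] (Y Y' : Matrix m m K) (t t' : K) :
    reindex e e (fromBlocks Y 0 0 !![t]) * reindex e e (fromBlocks Y' 0 0 !![t']) = reindex e e (fromBlocks (Y * Y') 0 0 !![t * t']) := by
  rw [reindex_apply, reindex_apply, reindex_apply, submatrix_mul_equiv, fromBlocks_multiply]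
  congr 1
  simp only [Matrix.mul_zero, Matrix.zero_mul, add_zero, zero_add]
  congr 1
  ext i j
  fin_cases i; fin_cases j
  simp [Matrix.mul_apply]

/-- `[1 0; 0 1] = 1`. [cite: HornJohnson2013, §0.9.2 (block diagonal matrices and direct sums)] -/
theorem blockFrame_one [DecidableEq m] [DecidableEq n] : reindex e e (fromBlocks (1 : Matrix m m K) 0 0 !![(1 : K)]) = 1 := by
  have h1 : !![(1 : K)] = (1 : Matrix (Fin 1) (Fin 1) K) := by
    ext i j; fin_cases i; fin_cases j; rfl
  rw [h1, fromBlocks_one, reindex_apply, submatrix_one_equiv]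

/-- `ᵗσ[Y 0; 0 t] = [ᵗσY 0; 0 σt]`. [cite: HornJohnson2013, §0.9.2 (block diagonal matrices and direct sums)] -/
theorem blockFrame_map_transpose (Y : Matrix m m K) (t : K) :
    ((reindex e e (fromBlocks Y 0 0 !![t])).map σ)ᵀ = reindex e e (fromBlocks ((Y.map σ)ᵀ) 0 0 !![σ t]) := by
  rw [reindex_apply, reindex_apply, ← submatrix_map, transpose_submatrix, fromBlocks_map, fromBlocks_transpose]
  congr 1
  have h0 : (0 : Matrix m (Fin 1) K).map σ = 0 := by ext; simp
  have h0' : (0 : Matrix (Fin 1) m K).map σ = 0 := by ext; simp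
  rw [h0, h0', transpose_zero, transpose_zero]
  congr 1
  ext i j; fin_cases i; fin_cases j; rfl

/-- `det [Y 0; 0 t] = det Y · t`. [cite: HornJohnson2013, §0.9.2 (block diagonal matrices and direct sums)] -/
theorem blockFrame_det [Fintype m] [DecidableEq m] [Fintype n] [DecidableEq n] (Y : Matrix m m K) (t : K) :
    (reindex e e (fromBlocks Y 0 0 !![t])).det = Y.det * t := by
  rw [det_reindex_self, det_fromBlocks_zero₂₁, det_fin_one, of_apply, cons_val_zero, cons_val_zero]

/-- `[Y 0; 0 t] = [Y′ 0; 0 t′] ↔ Y = Y′ ∧ t = t′`. [cite: HornJohnson2013, §0.9.2 (block diagonal matrices and direct sums)] -/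
theorem blockFrame_inj {Y Y' : Matrix m m K} {t t' : K} :
    reindex e e (fromBlocks Y 0 0 !![t]) = reindex e e (fromBlocks Y' 0 0 !![t']) ↔ Y = Y' ∧ t = t' := by
  rw [(reindex e e).injective.eq_iff, fromBlocks_inj]
  constructor
  · rintro ⟨hY, -, -, ht⟩
    exact ⟨hY, by simpa using congrFun (congrFun ht 0) 0⟩
  · rintro ⟨rfl, rfl⟩
    exact ⟨rfl, rfl, rfl, rfl⟩

/-- `[Y 0; 0 t]⁻¹ = [Y⁻¹ 0; 0 t⁻¹]` for `Y`, `t` invertible. [cite: HornJohnson2013, §0.9.2 (block diagonal matrices and direct sums)] -/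
theorem blockFrame_inv [Fintype m] [DecidableEq m] [Fintype n] [DecidableEq n] (Y : Matrix m m K) (hY : IsUnit Y.det) {t : K} (ht : t ≠ 0) :
    (reindex e e (fromBlocks Y 0 0 !![t]))⁻¹ = reindex e e (fromBlocks Y⁻¹ 0 0 !![t⁻¹]) := by
  apply Matrix.inv_eq_left_inv
  rw [blockFrame_mul, Matrix.nonsing_inv_mul Y hY, inv_mul_cancel₀ ht, blockFrame_one]

/-- `[Y 0; 0 t] + [Y′ 0; 0 t′] = [Y + Y′ 0; 0 t + t′]`. [cite: HornJohnson2013, §0.9.2 (block diagonal matrices and direct sums)] -/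
theorem blockFrame_add (Y Y' : Matrix m m K) (t t' : K) :
    reindex e e (fromBlocks Y 0 0 !![t]) + reindex e e (fromBlocks Y' 0 0 !![t']) = reindex e e (fromBlocks (Y + Y') 0 0 !![t + t']) := by
  have h := (reindexLinearEquiv K K e e).map_add (fromBlocks Y 0 0 !![t]) (fromBlocks Y' 0 0 !![t'])
  simp only [coe_reindexLinearEquiv] at h
  rw [← h, fromBlocks_add, add_zero, add_zero]
  congr 2
  ext i j; fin_cases i; fin_cases j; simp

/-- `c • [Y 0; 0 t] = [c • Y 0; 0 c t]`. [cite: HornJohnson2013, §0.9.2 (block diagonal matrices and direct sums)] -/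
theorem blockFrame_smul (c : K) (Y : Matrix m m K) (t : K) :
    c • reindex e e (fromBlocks Y 0 0 !![t]) = reindex e e (fromBlocks (c • Y) 0 0 !![c * t]) := by
  have h := (reindexLinearEquiv K K e e).map_smul c (fromBlocks Y 0 0 !![t])
  simp only [coe_reindexLinearEquiv] at h
  rw [← h, fromBlocks_smul, smul_zero, smul_zero]
  congr 2
  ext i j; fin_cases i; fin_cases j; simp

end Block

/-! ## §2 The Gram matrix and the adjoint in a `(2,1)` block frame of a unitary element -/

section Frame

variable {K : Type*} [Field K] (σ : K →+* K) {m n : Type*} [Fintype m] [DecidableEq m] [Fintype n] [DecidableEq n]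
  (e : m ⊕ Fin 1 ≃ n) (H : Matrix n n K)

/-- `P · P⁻¹ = 1` on matrices for `P ∈ GL_n`. [folklore] -/
private theorem coe_mul_coe_inv (P : GL n K) : P.val * (P⁻¹).val = 1 := by
  rw [← Units.val_mul, mul_inv_cancel, Units.val_one]

/-- `P⁻¹ · P = 1` on matrices for `P ∈ GL_n`. [folklore] -/
private theorem coe_inv_mul_coe (P : GL n K) : (P⁻¹).val * P.val = 1 := by
  rw [← Units.val_mul, inv_mul_cancel, Units.val_one]

/-- `det P ≠ 0` for `P ∈ GL_n(K)`. [folklore] -/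
private theorem det_coe_ne_zero (P : GL n K) : P.val.det ≠ 0 := by
  have h := P.isUnit
  rw [Matrix.isUnit_iff_isUnit_det] at h
  exact h.ne_zero

/-- **Transporting `H · x` to a frame**: `ᵗ(σP) · (H · P S P⁻¹) · P = H_P · S` (any `S`; ★ `twistGram_frame_mul_eigenframe_diagonal` is `S` diagonal).
[cite: Rogawski1990, §3.5 p. 29] -/
theorem twistGram_frame_mul_conj (P : GL n K) (S : Matrix n n K) :
    (P.val.map σ)ᵀ * (H * (P.val * S * (P⁻¹).val)) * P.val = twistGram σ H P.val * S := by
  rw [twistGram_def]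
  simp only [Matrix.mul_assoc, coe_inv_mul_coe, Matrix.mul_one]

/-- **The Gram matrix of `H` in the frame `gP`**: `H_{gP} = H_P · (P⁻¹ x P)` with `x = H⁻¹ H_g` (for `H` invertible; when `g` is a stable conjugator of
`γ`, `x ∈ Z(γ)` by ★ `commute_inv_mul_twistGram`). [cite: Rogawski1990, §3.1 p. 19; §3.5 Prop. 3.5.2 (a) p. 29] -/
theorem twistGram_mul_frame_eq (hH : IsUnit H.det) (g P : GL n K) :
    twistGram σ H (g.val * P.val) = twistGram σ H P.val * ((P⁻¹).val * (H⁻¹ * twistGram σ H g.val) * P.val) := by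
  have e1 : P.val * ((P⁻¹).val * (H⁻¹ * (twistGram σ H g.val * P.val))) = H⁻¹ * (twistGram σ H g.val * P.val) := by
    rw [← Matrix.mul_assoc P.val, coe_mul_coe_inv, Matrix.one_mul]
  calc twistGram σ H (g.val * P.val)
      = (P.val.map σ)ᵀ * twistGram σ H g.val * P.val := twistGram_mul σ H _ _
    _ = (P.val.map σ)ᵀ * (H * (H⁻¹ * twistGram σ H g.val)) * P.val := by
        rw [← Matrix.mul_assoc H, Matrix.mul_nonsing_inv H hH, Matrix.one_mul]
    _ = (P.val.map σ)ᵀ * H * P.val * ((P⁻¹).val * (H⁻¹ * twistGram σ H g.val) * P.val) := by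
        simp only [Matrix.mul_assoc, e1]
    _ = twistGram σ H P.val * ((P⁻¹).val * (H⁻¹ * twistGram σ H g.val) * P.val) := by rw [twistGram_def σ H P.val]

/-- `ᵗσ(P⁻¹) = (ᵗσP)⁻¹`. [folklore] -/
private theorem map_transpose_coe_inv (P : GL n K) : ((P⁻¹).val.map σ)ᵀ = ((P.val.map σ)ᵀ)⁻¹ := by
  refine (Matrix.inv_eq_left_inv ?_).symm
  rw [← transpose_mul, ← Matrix.map_mul, coe_mul_coe_inv, Matrix.map_one σ (map_zero σ) (map_one σ), transpose_one]

/-- **The adjoint in a frame**: `(P S P⁻¹)⋆_H = P · (S⋆_{H_P}) · P⁻¹` — conjugating by `P` carries the `H`-adjoint to the `H_P`-adjoint (`H_P = ᵗ(σP) H P`,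
`Matrix.inv` on both sides). [cite: Rogawski1990, §3.5 p. 29] -/
theorem hermStar_frame (P : GL n K) (S : Matrix n n K) :
    hermStar σ H (P.val * S * (P⁻¹).val) = P.val * hermStar σ (twistGram σ H P.val) S * (P⁻¹).val := by
  have hPinv : (P.val)⁻¹ = (P⁻¹).val := (Matrix.inv_eq_left_inv (coe_inv_mul_coe P))
  rw [hermStar_def, hermStar_def, twistGram_def, Matrix.map_mul, Matrix.map_mul, transpose_mul, transpose_mul, map_transpose_coe_inv,
    Matrix.mul_inv_rev, Matrix.mul_inv_rev, hPinv]
  -- both sides are `H⁻¹ (ᵗσP)⁻¹ ᵗσS ᵗσP H`, up to `P P⁻¹ = 1`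
  simp only [Matrix.mul_assoc, coe_mul_coe_inv, Matrix.mul_one]
  rw [← Matrix.mul_assoc P.val (P⁻¹).val, coe_mul_coe_inv, Matrix.one_mul]

omit [DecidableEq m] in
/-- `P · [Y 0; 0 t] · P⁻¹` commutes with `γ = P · [A 0; 0 u] · P⁻¹` as soon as `Y` commutes with `A`. [cite: Rogawski1990, §3.5 p. 29] -/
theorem commute_conj_blockFrame {γ : Matrix n n K} {P : GL n K} {A : Matrix m m K} {u : K}
    (hP : γ * P.val = P.val * reindex e e (fromBlocks A 0 0 !![u])) {Y : Matrix m m K} (hY : Commute Y A) (t : K) :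
    Commute (P.val * reindex e e (fromBlocks Y 0 0 !![t]) * (P⁻¹).val) γ := by
  have hγ : γ = P.val * reindex e e (fromBlocks A 0 0 !![u]) * (P⁻¹).val := by
    rw [← hP, Matrix.mul_assoc, coe_mul_coe_inv, Matrix.mul_one]
  have ePP : ∀ X : Matrix n n K, (P⁻¹).val * (P.val * X) = X := fun X => by rw [← Matrix.mul_assoc, coe_inv_mul_coe, Matrix.one_mul]
  rw [hγ]
  show P.val * reindex e e (fromBlocks Y 0 0 !![t]) * (P⁻¹).val * (P.val * reindex e e (fromBlocks A 0 0 !![u]) * (P⁻¹).val) =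
    P.val * reindex e e (fromBlocks A 0 0 !![u]) * (P⁻¹).val * (P.val * reindex e e (fromBlocks Y 0 0 !![t]) * (P⁻¹).val)
  have e2 : P.val * reindex e e (fromBlocks Y 0 0 !![t]) * (P⁻¹).val * (P.val * reindex e e (fromBlocks A 0 0 !![u]) * (P⁻¹).val) =
      P.val * (reindex e e (fromBlocks Y 0 0 !![t]) * reindex e e (fromBlocks A 0 0 !![u])) * (P⁻¹).val := by
    simp only [Matrix.mul_assoc, ePP]
  have e3 : P.val * reindex e e (fromBlocks A 0 0 !![u]) * (P⁻¹).val * (P.val * reindex e e (fromBlocks Y 0 0 !![t]) * (P⁻¹).val) =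
      P.val * (reindex e e (fromBlocks A 0 0 !![u]) * reindex e e (fromBlocks Y 0 0 !![t])) * (P⁻¹).val := by
    simp only [Matrix.mul_assoc, ePP]
  rw [e2, e3, blockFrame_mul, blockFrame_mul, hY.eq, mul_comm t u]

/-- `det (P · [Y 0; 0 t] · P⁻¹) = det Y · t`. [cite: HornJohnson2013, §0.9.2 (block diagonal matrices and direct sums)] -/
theorem det_conj_blockFrame (P : GL n K) (Y : Matrix m m K) (t : K) :
    (P.val * reindex e e (fromBlocks Y 0 0 !![t]) * (P⁻¹).val).det = Y.det * t := by
  rw [Matrix.det_mul, Matrix.det_mul, blockFrame_det, mul_comm, ← mul_assoc, ← Matrix.det_mul, coe_inv_mul_coe, Matrix.det_one, one_mul]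

omit [Fintype n] [DecidableEq n] in
/-- A square matrix WITHOUT eigenvalues in `K` (`χ_A(c) ≠ 0` for all `c`) has no eigenvector: `A v = c v ⇒ v = 0`. [folklore] -/
private theorem eq_zero_of_mulVec_eq_smul {A : Matrix m m K} (hA : ∀ c : K, A.charpoly.eval c ≠ 0) {v : m → K} {c : K}
    (hv : A *ᵥ v = c • v) : v = 0 := by
  by_contra hv0
  apply hA c
  rw [eval_charpoly]
  refine Matrix.exists_mulVec_eq_zero_iff.mp ⟨v, hv0, ?_⟩
  rw [Matrix.sub_mulVec, hv, scalar_apply, ← smul_one_eq_diagonal, smul_mulVec, one_mulVec, sub_self]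

omit [Fintype n] [DecidableEq n] in
/-- … and no left eigenvector: `v A = c v ⇒ v = 0`. [folklore] -/
private theorem eq_zero_of_vecMul_eq_smul {A : Matrix m m K} (hA : ∀ c : K, A.charpoly.eval c ≠ 0) {v : m → K} {c : K}
    (hv : v ᵥ* A = c • v) : v = 0 := by
  by_contra hv0
  apply hA c
  rw [eval_charpoly]
  refine Matrix.exists_vecMul_eq_zero_iff.mp ⟨v, hv0, ?_⟩
  rw [Matrix.vecMul_sub, hv, scalar_apply, ← smul_one_eq_diagonal, vecMul_smul, vecMul_one, sub_self]

omit [Fintype n] [DecidableEq n] in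
/-- `χ_{ᵗσA}` has no root in `K` when `χ_A` has none (`σ` an involution). [folklore] -/
private theorem eval_charpoly_map_transpose_ne_zero (hσ : ∀ r : K, σ (σ r) = r) {A : Matrix m m K} (hA : ∀ c : K, A.charpoly.eval c ≠ 0) (c : K) :
    ((A.map σ)ᵀ).charpoly.eval c ≠ 0 := by
  rw [charpoly_transpose, charpoly_map, ← hσ c, Polynomial.eval_map, Polynomial.eval₂_hom]
  exact fun h => hA (σ c) ((map_eq_zero_iff σ σ.injective).mp h)

/-- **The `u`-line of a `(2,1)` block frame of a unitary element is `H`-orthogonal to the block**: for `γ ∈ U(H)(K)` with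
`γ P = P · [A 0; 0 u]` and `χ_A` WITHOUT roots in `K`, the Gram matrix `H_P = ᵗ(σP) H P` is BLOCK-DIAGONAL, `H_P = [G₁ 0; 0 g₃]`, with
`ᵗ(σA) G₁ A = G₁` and `σ(u) g₃ u = g₃` — `ᵗ(σ(γP)) H (γP) = H_P` reads `[ᵗσA 0; 0 σu] H_P [A 0; 0 u] = H_P`, whose off-diagonal blocks are eigenvector
equations for `ᵗ(σA)` and `A`.  Type (2) of [Rogawski1990, §3.6] (`T = T_K × E¹`: `Z(γ) ≅ L′ × E` sits block-diagonally in an orthogonal frame); the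
analogue of ★ `twistGram_eigenframe_eq_diagonal` (type (1)). [cite: Rogawski1990, §3.6 p. 31; §3.5 p. 29] -/
theorem twistGram_blockFrame_eq (hσ : ∀ r : K, σ (σ r) = r) {γ : GL n K} (hγ : γ ∈ unitaryGroup σ H) {P : GL n K} {A : Matrix m m K} {u : K}
    (hP : γ.val * P.val = P.val * reindex e e (fromBlocks A 0 0 !![u])) (hA : ∀ c : K, A.charpoly.eval c ≠ 0) :
    ∃ (G₁ : Matrix m m K) (g₃ : K), twistGram σ H P.val = reindex e e (fromBlocks G₁ 0 0 !![g₃]) ∧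
      (A.map σ)ᵀ * G₁ * A = G₁ ∧ σ u * g₃ * u = g₃ := by
  -- `u ≠ 0` since `γ` is invertible
  have hu0 : u ≠ 0 := by
    intro h0
    have hdet : (γ.val * P.val).det = 0 := by rw [hP, Matrix.det_mul, blockFrame_det, h0, mul_zero, mul_zero]
    rw [Matrix.det_mul] at hdet
    exact mul_ne_zero (det_coe_ne_zero γ) (det_coe_ne_zero P) hdet
  have hσu0 : σ u ≠ 0 := (map_ne_zero σ).2 hu0
  -- the invariance equation in the frame
  set T := twistGram σ H P.val with hT
  have hinv : reindex e e (fromBlocks ((A.map σ)ᵀ) 0 0 !![σ u]) * T * reindex e e (fromBlocks A 0 0 !![u]) = T := by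
    have h1 : twistGram σ H (γ.val * P.val) = T := twistGram_unitary_mul σ H hγ _
    rwa [hP, twistGram_mul, blockFrame_map_transpose] at h1
  -- read it block by block on `T' = T.submatrix e e`
  set T' : Matrix (m ⊕ Fin 1) (m ⊕ Fin 1) K := (reindex e e).symm T with hT'
  have hTT' : T = reindex e e T' := by rw [hT', Equiv.apply_symm_apply]
  have hinv' : fromBlocks ((A.map σ)ᵀ) 0 0 !![σ u] * T' * fromBlocks A 0 0 !![u] = T' := by
    apply (reindex e e).injective
    rw [reindex_apply, reindex_apply, ← submatrix_mul_equiv (e₂ := e.symm), ← submatrix_mul_equiv (e₂ := e.symm) (M := fromBlocks _ _ _ _),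
      ← reindex_apply, ← reindex_apply, ← reindex_apply, ← hTT', hinv]
  rw [← fromBlocks_toBlocks T', fromBlocks_multiply, fromBlocks_multiply] at hinv'
  simp only [Matrix.zero_mul, Matrix.mul_zero, add_zero, zero_add] at hinv'
  obtain ⟨h11, h12, h21, h22⟩ := fromBlocks_inj.mp hinv'
  -- (1,2): `ᵗσA · T₁₂ · u = T₁₂` forces `T₁₂ = 0`
  have h12' : T'.toBlocks₁₂ = 0 := by
    ext i j
    fin_cases j
    have hcol : (A.map σ)ᵀ *ᵥ (fun i => T'.toBlocks₁₂ i 0) = u⁻¹ • fun i => T'.toBlocks₁₂ i 0 := by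
      ext i
      have h := congrFun (congrFun h12 i) 0
      rw [Matrix.mul_apply, Fin.sum_univ_one, Matrix.mul_apply, of_apply, cons_val_fin_one, cons_val_fin_one] at h
      rw [Pi.smul_apply, smul_eq_mul, eq_inv_mul_iff_mul_eq₀ hu0, ← h, mul_comm, mulVec, dotProduct]
    simpa using congrFun (eq_zero_of_mulVec_eq_smul (eval_charpoly_map_transpose_ne_zero σ hσ hA) hcol) i
  -- (2,1): `σu · T₂₁ · A = T₂₁` forces `T₂₁ = 0`
  have h21' : T'.toBlocks₂₁ = 0 := by
    ext i j
    fin_cases i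
    have hrow : (fun j => T'.toBlocks₂₁ 0 j) ᵥ* A = (σ u)⁻¹ • fun j => T'.toBlocks₂₁ 0 j := by
      ext j
      have h := congrFun (congrFun h21 0) j
      rw [Matrix.mul_apply] at h
      simp only [Matrix.mul_apply, Fin.sum_univ_one, of_apply, cons_val_fin_one] at h
      rw [Pi.smul_apply, smul_eq_mul, eq_inv_mul_iff_mul_eq₀ hσu0, ← h, vecMul, dotProduct, Finset.mul_sum]
      refine Finset.sum_congr rfl fun k _ => ?_
      ring
    simpa using congrFun (eq_zero_of_vecMul_eq_smul hA hrow) j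
  refine ⟨T'.toBlocks₁₁, T'.toBlocks₂₂ 0 0, ?_, h11, ?_⟩
  · rw [hTT']
    conv_lhs => rw [← fromBlocks_toBlocks T', h12', h21']
    congr 2
    ext i j; fin_cases i; fin_cases j; rfl
  · have h := congrFun (congrFun h22 0) 0
    simp only [Matrix.mul_apply, Fintype.sum_unique, of_apply, cons_val_zero] at h
    exact h

/-- In a block-diagonal frame: `H` hermitian non-degenerate ⇒ `G₁` hermitian with `det G₁ ≠ 0` and `g₃ = σ g₃ ≠ 0`. [cite: Rogawski1990, §3.5 p. 29] -/
theorem blockFrame_gram_hermitian (hσ : ∀ r : K, σ (σ r) = r) (hH : (H.map σ)ᵀ = H) (hHd : H.det ≠ 0) {P : GL n K} {G₁ : Matrix m m K} {g₃ : K}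
    (hT : twistGram σ H P.val = reindex e e (fromBlocks G₁ 0 0 !![g₃])) :
    (G₁.map σ)ᵀ = G₁ ∧ σ g₃ = g₃ ∧ G₁.det ≠ 0 ∧ g₃ ≠ 0 := by
  have hherm : ((twistGram σ H P.val).map σ)ᵀ = twistGram σ H P.val := conjTranspose_twistGram σ H hσ hH _
  rw [hT, blockFrame_map_transpose, blockFrame_inj] at hherm
  have hdet : (twistGram σ H P.val).det ≠ 0 := by
    rw [det_twistGram]
    exact mul_ne_zero (mul_ne_zero ((map_ne_zero σ).2 (det_coe_ne_zero P)) hHd) (det_coe_ne_zero P)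
  rw [hT, blockFrame_det] at hdet
  exact ⟨hherm.1, hherm.2, left_ne_zero_of_mul hdet, right_ne_zero_of_mul hdet⟩

/-- **The adjoint in a block-diagonal frame**: if `H_P = [G₁ 0; 0 g₃]` (`G₁` invertible, `g₃ ≠ 0`) then
`(P [Y 0; 0 t] P⁻¹)⋆_H = P [Y⋆_{G₁} 0; 0 σt] P⁻¹`.  So `⋆` acts on `Z(γ) ≅ K[A] × K` as `(⋆_{G₁}, σ)` — Rogawski's `(α′, σ)` on `L′ × E`.
[cite: Rogawski1990, §3.5 Prop. 3.5.2 (a) p. 29; §3.6 p. 31] -/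
theorem hermStar_conj_blockFrame {P : GL n K} {G₁ : Matrix m m K} {g₃ : K}
    (hT : twistGram σ H P.val = reindex e e (fromBlocks G₁ 0 0 !![g₃])) (hG₁ : IsUnit G₁.det) (hg₃ : g₃ ≠ 0) (Y : Matrix m m K) (t : K) :
    hermStar σ H (P.val * reindex e e (fromBlocks Y 0 0 !![t]) * (P⁻¹).val) =
      P.val * reindex e e (fromBlocks (hermStar σ G₁ Y) 0 0 !![σ t]) * (P⁻¹).val := by
  rw [hermStar_frame σ H, hermStar_def, hT, blockFrame_inv e G₁ hG₁ hg₃, blockFrame_map_transpose, blockFrame_mul, blockFrame_mul,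
    hermStar_def, show g₃⁻¹ * σ t * g₃ = σ t by field_simp]

omit [DecidableEq m] in
/-- **The Gram matrix of a stable conjugator in the block frame**: if `H_P = [G₁ 0; 0 g₃]` and the Cartan class of `g` reads `P⁻¹ (H⁻¹ H_g) P = [Y 0; 0 t]`,
then `H_{gP} = [G₁ Y 0; 0 g₃ t]`. [cite: Rogawski1990, §3.5 Prop. 3.5.2 (a) p. 29] -/
theorem twistGram_mul_blockFrame_eq (hH : IsUnit H.det) {P : GL n K} {G₁ : Matrix m m K} {g₃ : K}
    (hT : twistGram σ H P.val = reindex e e (fromBlocks G₁ 0 0 !![g₃])) {g : GL n K} {Y : Matrix m m K} {t : K}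
    (hx : (P⁻¹).val * (H⁻¹ * twistGram σ H g.val) * P.val = reindex e e (fromBlocks Y 0 0 !![t])) :
    twistGram σ H (g.val * P.val) = reindex e e (fromBlocks (G₁ * Y) 0 0 !![g₃ * t]) := by
  rw [twistGram_mul_frame_eq σ H hH, hx, hT, blockFrame_mul]

/-- **The determinant constraint**: if the Cartan class of `g` reads `[Y 0; 0 t]` in the frame then `det Y · t = σ(det g) det g` is a NORM
(★ `det_inv_mul_twistGram`; the source of «`Σ ε_j = 0`» in [Prop. 3.5.2 (c)]). [cite: Rogawski1990, §3.5 Prop. 3.5.2 (c) p. 29] -/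
theorem det_mul_eq_norm_of_blockFrame (hH : IsUnit H.det) {P : GL n K} {g : GL n K} {Y : Matrix m m K} {t : K}
    (hx : (P⁻¹).val * (H⁻¹ * twistGram σ H g.val) * P.val = reindex e e (fromBlocks Y 0 0 !![t])) :
    Y.det * t = σ g.val.det * g.val.det := by
  have h1 : (H⁻¹ * twistGram σ H g.val).det = σ g.val.det * g.val.det := det_inv_mul_twistGram σ H hH g.val
  have h2 : ((P⁻¹).val * (H⁻¹ * twistGram σ H g.val) * P.val).det = (H⁻¹ * twistGram σ H g.val).det := by
    rw [Matrix.det_mul, Matrix.det_mul, mul_comm, ← mul_assoc, ← Matrix.det_mul, coe_mul_coe_inv, Matrix.det_one, one_mul]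
  rw [← h1, ← h2, hx, blockFrame_det]

end Frame


end Literature.NumberTheory.Rogawski1990
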